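import Summits.MatrixMultiplication.MatrixMultiplication.Theorems.OutsiderSandwichAssistedCore
import Summits.MatrixMultiplication.MatrixMultiplication.Theses.OutsiderSandwich

/-!
# LANDING NOTE — PART 2 of 2 (decomp-mm-lander-1 g1, 2026-08-30; mechanical split for the 400-line lint)

Source: lens-4 gen-8 landing form `OutsiderSandwichAssisted.lean` (sha256 `52ddd361…4182`, 583 lines).  PART 1 =
`Theorems/OutsiderSandwichAssistedCore.lean` (source lines 61–424, route-free); this part = source lines 426–581 (sections
«TOP ⟺ the assisted table has sup-rate 3», «BOTTOM bounds every assisted cell pointwise», «The filed route items»,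
«The route items BY NAME»), copied byte-identically EXCEPT the tree-demanded rename of PART 1: the two binders `(hD : DiagonalAchieved)` are δ-unfolded to
the literal statement of the landed theorem `OutsiderSandwichHalfMM.diagonalAchieved` (the tree declares no such `def`);
imports PART 1 and `Theses.OutsiderSandwich`.  The original module docstring follows unchanged.
-/

/-!
# OutsiderSandwich — the ASSISTED TABLE: catalytic normal form of the extremal problem behind TOP
(decomp-mm lens 4 «minimal-counterexample / extremal reduction», gen 8)

The route `OutsiderSandwich` (`route-MatrixMultiplication-OutsiderSandwich`) cuts `ω(ℂ) = 2` into
TOP = `CwTwoMMPerfect` (`⟨m,m,m⟩ ≤ cw₂^{⊠N}` with `m² ≥ 3^{(1-ε)N}` cofinally) and BOTTOM =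
`LaserMergeOptimal`.  The census instrument is the HONEST table `I(N,m) : ⟨m,m,m⟩ ≤ cw₂^{⊠N}`; its
extremiser over everything known is NOT an honest cell but the lineage's `HalfMM : ⟨2,2,2⟩ ≤ cw₂ ⊠ ⟨2⟩`
(rate `4^{log₆3} = 2.3398` against `I(3,3)`'s `2.0801`).  This file makes the catalyst a coordinate:
the ASSISTED TABLE

  `A(N,m,r) : ⟨m,m,m⟩ ≤ cw₂^{⊠N} ⊠ ⟨r⟩`   (⟺ `⟨m,m,m⟩` is a sum of `r` restrictions of `cw₂^{⊠N}`),

with RATE `ρ(N,m,r) := (m²)^{1/(N + log₃ r)}` (the `r` catalyst copies are paid for at the diagonal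
price `Q̃(cw₂) = 3`, i.e. `log₃ r` copies of `cw₂` each).  Row `N = 0` is the table of ordinary
bilinear algorithms (`R(⟨m,m,m⟩) ≤ r`, rate `3^{2/ω_m}`), column `r = 1` is the census's honest
table.  Proved here, ω-free and in kernel (no hypothesis; the diagonal `Q̃(cw₂) = 3` in restriction
form is the lineage's kernel theorem `diagonalAchieved`, imported):

* `rate_of_assisted` — ONE assisted cell `A(N,m,r)` (`N, r ≥ 1`) gives the honest rate rung
  `CwTwoRate c` (cofinally many `⟨m',m',m'⟩ ≤ cw₂^{⊠N'}` with `c^{N'} ≤ m'²`) for EVERY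
  `0 ≤ c < ρ(N,m,r)` (powers of the cell, the catalyst `⟨r^k⟩` re-supplied by the diagonal of
  `≈ k·log₃ r` further copies) — aside `CwTwoRateOfAssisted`;
* `cwTwoMMPerfect_iff_assisted` — TOP ⟺ `sup ρ = 3` over the assisted table: catalysts do not
  change TOP, but they change WHERE to look (aside `CwTwoMMPerfectAssistedIff`);
* `tensorRank_matMul_le_of_assisted` — the RANK PRICE of a cell: `A(N,m,r) ⟹ R(⟨m,m,m⟩) ≤ 4^N·r`
  (`R(cw₂) = 4`, submultiplicativity); so an honest cell beyond print (`ρ > 2^{ℓ(ω̄)} = 2.71537`)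
  is a `cw₂`-STRUCTURED bilinear algorithm for `⟨m,m,m⟩` of effective exponent
  `log_m R < 2·log 4 / log 2.71537 = 2.7756` (aside `AssistedRankPrice`);
* `assisted_bound_of_laserMergeOptimal` — BOTTOM bounds every assisted cell pointwise:
  `m² ≤ 2^{ℓ(ω)·(N + log₃ r)}` (aside `LaserMergeOptimalAssisted`), so ONE assisted cell with
  `ρ > 2^{ℓ(ω')}` refutes BOTTOM in every world `ω ≥ ω'` exactly like an honest one.

All statements are over the tree's `TensorRestrictsTo`, `kroneckerTensor`, `kroneckerPow`, `cwTensor`,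
`unitTensor`, `matMulTensor`, `tensorRank`, `omega`; no new `Prop` definitions besides the verbatim
copies of the filed route items (section `Filed`).
Sources: BurgisserClausenShokrollahi1997 ((14.19), Prop. 14.23, §15.5), Blaser2013 (Lemma 5.4, 5.8),
CoppersmithWinograd1990 (§6, §11), ConnerHuangLandsberg2020 (`R(cw₂) = 4` torus family),
ConnerGesmundoLandsbergVentura2022 (`Q̃(cw₂) = 3`), Strassen1987 (relative exponents).
-/

set_option linter.dupNamespace false

namespace Summit.MatrixMultiplication.MatrixMultiplication.Theorems.OutsiderSandwichAssisted

open scoped BigOperators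
open Complex
open Literature.Computability.AlgebraicComplexity
open Summit.MatrixMultiplication.MatrixMultiplication.Theorems.OutsiderSandwichHalfMM (diagonalAchieved)

/-! ## TOP ⟺ the assisted table has sup-rate `3` -/

section Top

/-- **TOP ⟹ assisted-perfect** (`r = 1`). [folklore] -/
theorem assisted_of_cwTwoMMPerfect
    (h : Summit.MatrixMultiplication.MatrixMultiplication.Theses.OutsiderSandwich.CwTwoMMPerfect) :
    ∀ ε : ℝ, 0 < ε → ∃ N m r : ℕ, 1 ≤ N ∧ 1 ≤ r ∧
      TensorRestrictsTo (kroneckerTensor (kroneckerPow (cwTensor ℂ 2) N) (unitTensor ℂ r))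
        (matMulTensor ℂ m m m) ∧
      (3 : ℝ) ^ ((1 - ε) * ((N : ℝ) + Real.logb 3 r)) ≤ (m : ℝ) ^ 2 := by
  classical
  intro ε hε
  obtain ⟨N, hN, m, hI, hle⟩ := h ε hε 1
  refine ⟨N, m, 1, hN, le_rfl, (kronecker_unitOne_restrictsTo _).trans hI, ?_⟩
  simpa [Real.logb_one] using hle

/-- **TOP ⟺ assisted-perfect.**  (→): `r = 1`.  (←): a cell of rate `> 3^{1-ε/2}` feeds
`rate_of_assisted` at `c = 3^{1-ε}`. [new] -/
theorem cwTwoMMPerfect_iff_assisted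
    (hD : ∀ ε : ℝ, 0 < ε → ∀ N₀ : ℕ, ∃ N : ℕ, N₀ ≤ N ∧ ∃ r : ℕ,
      TensorRestrictsTo (kroneckerPow (cwTensor ℂ 2) N) (unitTensor ℂ r) ∧ (3 : ℝ) ^ ((1 - ε) * N) ≤ (r : ℝ)) :
    Summit.MatrixMultiplication.MatrixMultiplication.Theses.OutsiderSandwich.CwTwoMMPerfect ↔
    ∀ ε : ℝ, 0 < ε → ∃ N m r : ℕ, 1 ≤ N ∧ 1 ≤ r ∧
      TensorRestrictsTo (kroneckerTensor (kroneckerPow (cwTensor ℂ 2) N) (unitTensor ℂ r))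
        (matMulTensor ℂ m m m) ∧
      (3 : ℝ) ^ ((1 - ε) * ((N : ℝ) + Real.logb 3 r)) ≤ (m : ℝ) ^ 2 := by
  refine ⟨assisted_of_cwTwoMMPerfect, fun h => ?_⟩
  intro ε hε N₀
  obtain ⟨N, m, r, hN, hr, hA, hle⟩ := h (ε / 2) (by linarith)
  have hx : 0 < (N : ℝ) + Real.logb 3 r := by
    have h1 : (1 : ℝ) ≤ N := by exact_mod_cast hN
    have h2 : 0 ≤ Real.logb 3 (r : ℝ) := Real.logb_nonneg (by norm_num) (by exact_mod_cast hr)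
    linarith
  have hc0 : (0 : ℝ) ≤ (3 : ℝ) ^ (1 - ε) := Real.rpow_nonneg (by norm_num) _
  have hc : ((3 : ℝ) ^ (1 - ε)) ^ ((N : ℝ) + Real.logb 3 r) < (m : ℝ) ^ 2 := by
    rw [← Real.rpow_mul (by norm_num)]
    refine lt_of_lt_of_le ?_ hle
    exact Real.rpow_lt_rpow_of_exponent_lt (by norm_num) (by nlinarith)
  obtain ⟨N', hN', m', hI', hcN'⟩ := rate_of_assisted hD hN hr hA hc0 hc N₀
  refine ⟨N', hN', m', hI', ?_⟩
  have e : ((3 : ℝ) ^ (1 - ε)) ^ N' = (3 : ℝ) ^ ((1 - ε) * N') := by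
    rw [← Real.rpow_natCast, ← Real.rpow_mul (by norm_num)]
  rwa [e] at hcN'

end Top

/-! ## BOTTOM bounds every assisted cell pointwise -/

section Bottom

/-- **BOTTOM ⟹ `m² ≤ 2^{ℓ(ω)(N + log₃ r)}` for every assisted cell** (`N, r ≥ 1`): otherwise some
`c = 2^{ℓ+δ}` lies strictly between `2^ℓ` and the cell's rate, `rate_of_assisted` makes `CwTwoRate c`
cofinal, and BOTTOM at slack `δ/2` bounds those cells by `2^{(ℓ+δ/2)N'} < c^{N'}`. [new] -/
theorem assisted_bound_of_laserMergeOptimal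
    (hD : ∀ ε : ℝ, 0 < ε → ∀ N₀ : ℕ, ∃ N : ℕ, N₀ ≤ N ∧ ∃ r : ℕ,
      TensorRestrictsTo (kroneckerPow (cwTensor ℂ 2) N) (unitTensor ℂ r) ∧ (3 : ℝ) ^ ((1 - ε) * N) ≤ (r : ℝ))
    (hB : Summit.MatrixMultiplication.MatrixMultiplication.Theses.OutsiderSandwich.LaserMergeOptimal)
    {N m r : ℕ} (hN : 1 ≤ N) (hr : 1 ≤ r)
    (hA : TensorRestrictsTo (kroneckerTensor (kroneckerPow (cwTensor ℂ 2) N) (unitTensor ℂ r))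
      (matMulTensor ℂ m m m)) :
    (m : ℝ) ^ 2 ≤ (2 : ℝ) ^ ((2 / 3 + 2 / omega ℂ * (Real.logb 2 3 - 2 / 3)) * ((N : ℝ) + Real.logb 3 r)) := by
  set ℓ : ℝ := 2 / 3 + 2 / omega ℂ * (Real.logb 2 3 - 2 / 3) with hℓ
  set x : ℝ := (N : ℝ) + Real.logb 3 r with hxdef
  by_contra hlt
  push Not at hlt
  have hx : 0 < x := by
    have h1 : (1 : ℝ) ≤ N := by exact_mod_cast hN
    have h2 : 0 ≤ Real.logb 3 (r : ℝ) := Real.logb_nonneg (by norm_num) (by exact_mod_cast hr)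
    rw [hxdef]; linarith
  have hL2 : 0 < Real.log 2 := Real.log_pos one_lt_two
  have h2x : (0 : ℝ) < (2 : ℝ) ^ (ℓ * x) := Real.rpow_pos_of_pos (by norm_num) _
  have hmpos : (0 : ℝ) < m := by
    rcases Nat.eq_zero_or_pos m with rfl | hm
    · simp at hlt; linarith
    · exact_mod_cast hm
  -- the gap `a = 2 log m − ℓ x log 2 > 0`
  have hgap : ℓ * x * Real.log 2 < 2 * Real.log m := by
    have h1 := Real.log_lt_log h2x hlt
    rwa [Real.log_rpow (by norm_num), Real.log_pow, Nat.cast_ofNat] at h1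
  set a : ℝ := 2 * Real.log m - ℓ * x * Real.log 2 with hadef
  have ha : 0 < a := by rw [hadef]; linarith
  set δ : ℝ := a / (2 * x * Real.log 2) with hδdef
  have hδ : 0 < δ := by positivity
  have hδx : δ * x * Real.log 2 = a / 2 := by
    rw [hδdef]; field_simp
  -- `c = 2^{ℓ+δ}` is below the cell's rate
  set c : ℝ := (2 : ℝ) ^ (ℓ + δ) with hcdef
  have hcpos : 0 < c := Real.rpow_pos_of_pos (by norm_num) _
  have hc : c ^ x < (m : ℝ) ^ 2 := by
    have hcx : c ^ x = (2 : ℝ) ^ ((ℓ + δ) * x) := by rw [hcdef, ← Real.rpow_mul (by norm_num)]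
    have hm2 : (0 : ℝ) < (m : ℝ) ^ 2 := by positivity
    rw [hcx, ← Real.log_lt_log_iff (Real.rpow_pos_of_pos (by norm_num) _) hm2, Real.log_rpow (by norm_num),
      Real.log_pow, Nat.cast_ofNat]
    nlinarith
  -- BOTTOM at slack `δ/2` vs the cofinal rung `CwTwoRate c`
  obtain ⟨N₁, hN₁⟩ := hB (δ / 2) (by positivity)
  obtain ⟨N', hN', m', hI', hcN'⟩ := rate_of_assisted hD hN hr hA hcpos.le hc (max N₁ 1)
  have hB' := hN₁ N' (le_of_max_le_left hN') m' hI'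
  have hN'1 : (1 : ℝ) ≤ N' := by exact_mod_cast le_of_max_le_right hN'
  have e : c ^ N' = (2 : ℝ) ^ ((ℓ + δ) * N') := by
    rw [hcdef, ← Real.rpow_natCast, ← Real.rpow_mul (by norm_num)]
  rw [e] at hcN'
  have h3 := hcN'.trans hB'
  rw [Real.rpow_le_rpow_left_iff one_lt_two] at h3
  nlinarith

end Bottom

/-! ## The filed route items (verbatim) and their proofs BY NAME -/

section Filed

/-- Filed text of aside `CwTwoRateOfAssisted`. -/
theorem cwTwoRateOfAssisted_filed :
    ∀ N m r : ℕ, 1 ≤ N → 1 ≤ r → Literature.Computability.AlgebraicComplexity.TensorRestrictsTo (Literature.Computability.AlgebraicComplexity.kroneckerTensor (Literature.Computability.AlgebraicComplexity.kroneckerPow (Literature.Computability.AlgebraicComplexity.cwTensor ℂ 2) N) (Literature.Computability.AlgebraicComplexity.unitTensor ℂ r)) (Literature.Computability.AlgebraicComplexity.matMulTensor ℂ m m m) → ∀ c : ℝ, 0 ≤ c → c ^ ((N : ℝ) + Real.logb 3 r) < (m : ℝ) ^ 2 → ∀ N₀ : ℕ, ∃ N' : ℕ, N₀ ≤ N' ∧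 ∃ m' : ℕ, Literature.Computability.AlgebraicComplexity.TensorRestrictsTo (Literature.Computability.AlgebraicComplexity.kroneckerPow (Literature.Computability.AlgebraicComplexity.cwTensor ℂ 2) N') (Literature.Computability.AlgebraicComplexity.matMulTensor ℂ m' m' m') ∧ c ^ N' ≤ (m' : ℝ) ^ 2 :=
  fun _ _ _ hN hr hA _ hc0 hc N₀ => rate_of_assisted diagonalAchieved hN hr hA hc0 hc N₀

/-- Filed text of aside `CwTwoMMPerfectAssistedIff`. -/
theorem cwTwoMMPerfectAssistedIff_filed :
    Summit.MatrixMultiplication.MatrixMultiplication.Theses.OutsiderSandwich.CwTwoMMPerfect ↔ ∀ ε : ℝ, 0 < ε → ∃ N m r : ℕ, 1 ≤ N ∧ 1 ≤ r ∧ Literature.Computability.AlgebraicComplexity.TensorRestrictsTo (Literature.Computability.AlgebraicComplexity.kroneckerTensor (Literature.Computability.AlgebraicComplexity.kroneckerPow (Literature.Computability.AlgebraicComplexity.cwTensor ℂ 2) N) (Literature.Computability.AlgebraicComplexity.unitTensor ℂ r)) (Literature.Computability.AlgebraicComplexity.matMulTensor ℂ m m m) ∧ (3 : ℝ) ^ ((1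 - ε) * ((N : ℝ) + Real.logb 3 r)) ≤ (m : ℝ) ^ 2 :=
  cwTwoMMPerfect_iff_assisted diagonalAchieved

/-- Filed text of aside `AssistedRankPrice`. -/
theorem assistedRankPrice_filed :
    ∀ N m r : ℕ, Literature.Computability.AlgebraicComplexity.TensorRestrictsTo (Literature.Computability.AlgebraicComplexity.kroneckerTensor (Literature.Computability.AlgebraicComplexity.kroneckerPow (Literature.Computability.AlgebraicComplexity.cwTensor ℂ 2) N) (Literature.Computability.AlgebraicComplexity.unitTensor ℂ r)) (Literature.Computability.AlgebraicComplexity.matMulTensor ℂ m m m) → Literature.Computability.AlgebraicComplexity.tensorRank (Literature.Computability.AlgebraicComplexity.matMulTensor ℂ m m m) ≤ 4 ^ N * r :=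
  fun _ _ _ hA => tensorRank_matMul_le_of_assisted hA

/-- Filed text of aside `LaserMergeOptimalAssisted`. -/
theorem laserMergeOptimalAssisted_filed :
    Summit.MatrixMultiplication.MatrixMultiplication.Theses.OutsiderSandwich.LaserMergeOptimal → ∀ N m r : ℕ, 1 ≤ N → 1 ≤ r → Literature.Computability.AlgebraicComplexity.TensorRestrictsTo (Literature.Computability.AlgebraicComplexity.kroneckerTensor (Literature.Computability.AlgebraicComplexity.kroneckerPow (Literature.Computability.AlgebraicComplexity.cwTensor ℂ 2) N) (Literature.Computability.AlgebraicComplexity.unitTensor ℂ r)) (Literature.Computability.AlgebraicComplexity.matMulTensor ℂ m m m) → (m : ℝ) ^ 2 ≤ (2 : ℝ) ^ ((2 / 3 + 2 / Literature.Computability.AlgebraicComplexity.omega ℂ * (Real.logb 2 3 - 2 / 3)) * ((N : ℝ) + Real.logb 3 r)) :=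
  fun hB _ _ _ hN hr hA => assisted_bound_of_laserMergeOptimal diagonalAchieved hB hN hr hA

end Filed

/-! ## The route items BY NAME (route file rev 6, items stmt-MatrixMultiplication-31282 … 31285) -/

section Holds

/-- Route item `OutsiderSandwich.CwTwoRateOfAssisted` (stmt-MatrixMultiplication-31282) holds. -/
theorem cwTwoRateOfAssisted_holds :
    Summit.MatrixMultiplication.MatrixMultiplication.Theses.OutsiderSandwich.CwTwoRateOfAssisted :=
  cwTwoRateOfAssisted_filed

/-- Route item `OutsiderSandwich.CwTwoMMPerfectAssistedIff` (stmt-MatrixMultiplication-31283) holds. -/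
theorem cwTwoMMPerfectAssistedIff_holds :
    Summit.MatrixMultiplication.MatrixMultiplication.Theses.OutsiderSandwich.CwTwoMMPerfectAssistedIff :=
  cwTwoMMPerfectAssistedIff_filed

/-- Route item `OutsiderSandwich.AssistedRankPrice` (stmt-MatrixMultiplication-31284) holds. -/
theorem assistedRankPrice_holds :
    Summit.MatrixMultiplication.MatrixMultiplication.Theses.OutsiderSandwich.AssistedRankPrice :=
  assistedRankPrice_filed

/-- Route item `OutsiderSandwich.LaserMergeOptimalAssisted` (stmt-MatrixMultiplication-31285) holds. -/
theorem laserMergeOptimalAssisted_holds :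
    Summit.MatrixMultiplication.MatrixMultiplication.Theses.OutsiderSandwich.LaserMergeOptimalAssisted :=
  laserMergeOptimalAssisted_filed

end Holds

end Summit.MatrixMultiplication.MatrixMultiplication.Theorems.OutsiderSandwichAssisted
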